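import Literature.Barriers.QuantumFields.EguchiKawaiBreakdownProofs
import Literature.Barriers.QuantumFields.UnitaryHaarSmallBall
import Mathlib.MeasureTheory.Integral.Layercake
import Mathlib.Analysis.SpecialFunctions.Integrals.Basic
import HarnessLib

/-!
# `EguchiKawaiBreakdown`: the collapsed-vacuum lower bound proved; the barrier reduced to one `N`-uniform small-ball estimate

Third file of the unit on the named fact `Literature.Barriers.QuantumFields.EguchiKawaiBreakdown`
(Makeenko, *Methods of Contemporary Gauge Theory*, §14.3 p. 246 and §14.5 p. 251, after
Bhanot–Heller–Neuberger 1982: the `U(1)^d` symmetry of the Eguchi–Kawai model is spontaneously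
broken at weak coupling for `d > 2`).

`EguchiKawaiBreakdownProofs.lean` reduced the fact to two free-energy estimates on the reduced
model (`EguchiKawaiBreakdown_of_bounds`): a LOWER bound on the partition function with the
Laplace exponent `d/4` of the collapsed vacua,

  `EKPartitionLowerBound d C :  Z_N(b) = ∫ ∏ dU_μ e^{−N² b S_R} ≥ exp(−N²((d/4) log b + C))`
  for all `N ≥ N₀`, `b ≥ 1`,

and an UPPER bound on the centre-symmetric region with a strictly larger exponent
(`EKSymRegionUpperBound d δ e C`, `e > d/4`). This file PROVES the lower bound, for every `d`,
with the explicit constant `C = d log(2π + 1) + d²` and `N₀ = 1`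
(`ekPartitionLowerBound_holds`), so that the barrier now rests on the upper bound alone
(`EguchiKawaiBreakdown_of_upperBound`); and it reduces that upper bound, by the layer-cake
(Laplace-transform) formula, to its cleanest form — an `N`-uniform SMALL-BALL estimate for the
product Haar measure of the centre-symmetric almost-commuting `d`-tuples of unitaries,

  `EKSymSmallBallBound d δ e C :  Haar^{⊗d} (Sym_δ ∩ {S_R ≤ t}) ≤ exp(N²(e log t + C))`
  for all `N ≥ N₀`, `t > 0`                                    (a HYPOTHESIS, e > d/4 needed),

(`ekSymRegionUpperBound_of_smallBall`, `EguchiKawaiBreakdown_of_smallBall`). Without the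
restriction to `Sym_δ` the exponent `d/4` is attained (`ekHaar_action_le_ge`: the unrestricted
small-ball probability is `≥ (c t^{1/4})^{dN²}`), so any such bound with `e > d/4` must come from
the centre symmetry — the quantitative, `N`-uniform form of "for `d ≥ 3` the measure is singular
and the eigenvalues collapse" (Makeenko p. 251; the one-loop power count gives
`e ≥ d/4 + (1 − Σ_i f_i²)(d − 2)/4` around vacua with eigenvalue-cluster fractions `f_i`, and
`Σ f_i² < 1` is forced by `|tr U_μ/N|² ≤ δ < 1`). This small-ball estimate is the genuinely
unproved mathematical content of the printed claim and is NOT asserted anywhere; no proof of it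
(or of the breakdown) exists in print — [BHN82] and Makeenko §14.5 give the one-loop computation
(14.77) and numerics.

## The proof (Makeenko's "(14.74) has no quadratic term at `P_μ = 0`", made quantitative)

* Operator-norm/Frobenius inequalities for the explicit Frobenius sums of the parent files
  (`frobSq M = Σ_{ij} |M_ij|²`, equal to `ekCommNormSq` on commutators): `‖XY‖_F² ≤ ‖X‖_op² ‖Y‖_F²`,
  `‖YX‖_F² ≤ ‖X‖_op² ‖Y‖_F²`, `‖Y‖_F² ≤ N ‖Y‖_op²` (`frobSq_mul_le`, `frobSq_mul_le'`,
  `frobSq_le_card_mul`), whence the COMMUTATOR BOUND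
  `‖[A, B]‖_F² = ‖[A − 1, B − 1]‖_F² ≤ 4N ‖A − 1‖_op² ‖B − 1‖_op²` (`frobSq_comm_le`).
* Hence on the operator-norm ball `‖U_μ − 1‖_op ≤ ε` (all `μ`) the reduced action (14.38), in its
  commutator form `S_R = Σ_{μν} ‖[U_μ,U_ν]‖_F²/(4N)` (`ekAction_eq_sum_ekCommNormSq`), is QUARTICALLY
  small, `S_R ≤ d² ε⁴`, uniformly in `N` (`ekAction_le_of_mem_unitaryOpBall`).
* With `ε = b^{−1/4}` the Boltzmann weight is `≥ e^{−d² N²}` on the box `∏_μ {‖U_μ − 1‖_op ≤ ε}`,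
  whose product-Haar measure is `≥ (ε/(2π + ε))^{dN²}` by the `N`-uniform small-ball bound
  `haar_unitaryOpBall_ge` of `UnitaryHaarSmallBall.lean`; so
  `Z_N(b) ≥ e^{−d²N²} (b^{−1/4}/(2π + 1))^{dN²} = exp(−N²((d/4) log b + d log(2π + 1) + d²))`.
* Layer cake: `∫_{Sym_δ} e^{−N² b S_R} = ∫₀^∞ Haar(Sym_δ ∩ {e^{−N² b S_R} > s}) ds
  = ∫₀¹ Haar(Sym_δ ∩ {S_R < −log s/(N² b)}) ds`; under the small-ball bound the integrand is
  `≤ e^{CN²} L^{eN²}` with `L = −log s/(N² b)`, and the elementary `log y ≤ y − 1` (at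
  `y = bL/(2e)`) gives `e^{CN²} L^{eN²} ≤ e^{N²(C + e log(2e) − e − e log b)} s^{−1/2}`, whence
  `∫_{Sym_δ} e^{−N² b S_R} ≤ 2 e^{N²(C + e log(2e) − e)} b^{−eN²} ≤ exp(−N²(e log b − C'))`,
  `C' = C + e log(2e) − e + log 2` (`ekSymRegionUpperBound_of_smallBall`).

## References

* Y. Makeenko, *Methods of Contemporary Gauge Theory* (CUP, reissue 2023), §14.3 (14.38),
  (14.40) (PDF pp. 244–245), §14.5 (14.72)–(14.77) (PDF p. 251).
* G. Bhanot, U. M. Heller, H. Neuberger, Phys. Lett. B 113 (1982) 47 (via Makeenko [BHN82]).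
-/

noncomputable section

open Complex NormedSpace MeasureTheory Filter Set
open scoped Real Matrix Matrix.Norms.L2Operator ENNReal NNReal Topology

namespace Literature.Barriers.QuantumFields

variable {N : ℕ}

/-! ### Frobenius sums versus the L²-operator norm -/

/-- The squared Frobenius norm as an explicit sum, `frobSq M = Σ_{i,j} |M_{ij}|²` (the form used
by `ekCommNormSq` and `linkDevSq` in the parent files; no norm instance is involved). [folklore] -/
def frobSq (M : Matrix (Fin N) (Fin N) ℂ) : ℝ := ∑ i, ∑ j, ‖M i j‖ ^ 2

/-- `frobSq ≥ 0`. [folklore] -/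
theorem frobSq_nonneg (M : Matrix (Fin N) (Fin N) ℂ) : 0 ≤ frobSq M :=
  Finset.sum_nonneg fun _ _ => Finset.sum_nonneg fun _ _ => by positivity

/-- Column form: `‖M‖_F² = Σ_j ‖M e_j‖₂²`. [folklore] -/
theorem frobSq_eq_sum_col (M : Matrix (Fin N) (Fin N) ℂ) :
    frobSq M = ∑ j, ‖(EuclideanSpace.equiv (Fin N) ℂ).symm (M.col j)‖ ^ 2 := by
  rw [frobSq, Finset.sum_comm]
  refine Finset.sum_congr rfl fun j _ => ?_
  rw [EuclideanSpace.norm_sq_eq]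
  rfl

/-- Columns of a product: `(XY) e_j = X (Y e_j)`. [folklore] -/
theorem col_mul_eq_mulVec (X Y : Matrix (Fin N) (Fin N) ℂ) (j : Fin N) :
    (X * Y).col j = Matrix.mulVec X (Y.col j) := by
  ext i
  simp [Matrix.mul_apply, Matrix.mulVec, dotProduct]

/-- `‖XY‖_F² ≤ ‖X‖_op² ‖Y‖_F²`. [folklore] -/
theorem frobSq_mul_le (X Y : Matrix (Fin N) (Fin N) ℂ) : frobSq (X * Y) ≤ ‖X‖ ^ 2 * frobSq Y := by
  rw [frobSq_eq_sum_col, frobSq_eq_sum_col, Finset.mul_sum]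
  refine Finset.sum_le_sum fun j _ => ?_
  rw [col_mul_eq_mulVec]
  set w : EuclideanSpace ℂ (Fin N) := (EuclideanSpace.equiv (Fin N) ℂ).symm (Y.col j) with hw
  have hwo : w.ofLp = Y.col j := rfl
  have h := Matrix.l2_opNorm_mulVec X w
  rw [hwo] at h
  have h0 : 0 ≤ ‖(EuclideanSpace.equiv (Fin N) ℂ).symm (Matrix.mulVec X (Y.col j))‖ := norm_nonneg _
  calc ‖(EuclideanSpace.equiv (Fin N) ℂ).symm (Matrix.mulVec X (Y.col j))‖ ^ 2
      ≤ (‖X‖ * ‖(EuclideanSpace.equiv (Fin N) ℂ).symm (Y.col j)‖) ^ 2 := pow_le_pow_left₀ h0 h 2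
    _ = ‖X‖ ^ 2 * ‖(EuclideanSpace.equiv (Fin N) ℂ).symm (Y.col j)‖ ^ 2 := by ring

/-- `‖Mᴴ‖_F² = ‖M‖_F²`. [folklore] -/
theorem frobSq_conjTranspose (M : Matrix (Fin N) (Fin N) ℂ) : frobSq Mᴴ = frobSq M := by
  rw [frobSq, frobSq, Finset.sum_comm]
  simp [Matrix.conjTranspose_apply]

/-- `‖YX‖_F² ≤ ‖X‖_op² ‖Y‖_F²` (from the previous bound by taking adjoints,
`‖Xᴴ‖_op = ‖X‖_op`). [folklore] -/
theorem frobSq_mul_le' (X Y : Matrix (Fin N) (Fin N) ℂ) : frobSq (Y * X) ≤ ‖X‖ ^ 2 * frobSq Y := by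
  rw [← frobSq_conjTranspose, Matrix.conjTranspose_mul]
  calc frobSq (Xᴴ * Yᴴ) ≤ ‖Xᴴ‖ ^ 2 * frobSq Yᴴ := frobSq_mul_le _ _
    _ = ‖X‖ ^ 2 * frobSq Y := by rw [Matrix.l2_opNorm_conjTranspose, frobSq_conjTranspose]

/-- `‖Y‖_F² ≤ N ‖Y‖_op²` (each of the `N` columns has Euclidean norm `≤ ‖Y‖_op`). [folklore] -/
theorem frobSq_le_card_mul (Y : Matrix (Fin N) (Fin N) ℂ) : frobSq Y ≤ N * ‖Y‖ ^ 2 := by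
  rw [frobSq_eq_sum_col]
  calc ∑ j, ‖(EuclideanSpace.equiv (Fin N) ℂ).symm (Y.col j)‖ ^ 2 ≤ ∑ _j : Fin N, ‖Y‖ ^ 2 := by
        refine Finset.sum_le_sum fun j _ => ?_
        set v : EuclideanSpace ℂ (Fin N) := PiLp.single 2 j (1 : ℂ) with hv
        have hv1 : ‖v‖ = 1 := by rw [hv, PiLp.norm_single, norm_one]
        have h := Matrix.l2_opNorm_mulVec Y v
        rw [hv1, mul_one] at h
        have hcol : Matrix.mulVec Y v.ofLp = Y.col j := by
          have : v.ofLp = Pi.single j 1 := by rw [hv]; rfl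
          rw [this, Matrix.mulVec_single_one]
        rw [hcol] at h
        exact pow_le_pow_left₀ (norm_nonneg _) h 2
    _ = N * ‖Y‖ ^ 2 := by simp

/-- `‖A − B‖_F² ≤ 2‖A‖_F² + 2‖B‖_F²`. [folklore] -/
theorem frobSq_sub_le (A B : Matrix (Fin N) (Fin N) ℂ) :
    frobSq (A - B) ≤ 2 * frobSq A + 2 * frobSq B := by
  simp only [frobSq, Finset.mul_sum, ← Finset.sum_add_distrib]
  refine Finset.sum_le_sum fun i _ => Finset.sum_le_sum fun j _ => ?_
  rw [Matrix.sub_apply]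
  have h := norm_sub_le (A i j) (B i j)
  have h0 := norm_nonneg (A i j - B i j)
  have h1 : ‖A i j - B i j‖ ^ 2 ≤ (‖A i j‖ + ‖B i j‖) ^ 2 := pow_le_pow_left₀ h0 h 2
  nlinarith [sq_nonneg (‖A i j‖ - ‖B i j‖)]

/-- **Commutator bound at the centre**: `‖[A,B]‖_F² = ‖[A − 1, B − 1]‖_F² ≤ 4N ‖A − 1‖_op² ‖B − 1‖_op²`
— the commutator is quartically small in the operator-norm distance to the collapsed vacuum,
uniformly in `N` per unit of `N` (compare `ekCommNormSq_le`, the all-Frobenius version of the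
parent file, which is not `N`-uniform in this sense). [folklore] -/
theorem frobSq_comm_le (A B : Matrix (Fin N) (Fin N) ℂ) :
    frobSq (A * B - B * A) ≤ 4 * N * ‖A - 1‖ ^ 2 * ‖B - 1‖ ^ 2 := by
  have hcomm : A * B - B * A = (A - 1) * (B - 1) - (B - 1) * (A - 1) := by noncomm_ring
  rw [hcomm]
  have h1 := frobSq_sub_le ((A - 1) * (B - 1)) ((B - 1) * (A - 1))
  have h2 := frobSq_mul_le (A - 1) (B - 1)
  have h3 := frobSq_mul_le' (A - 1) (B - 1)
  have h4 := frobSq_le_card_mul (B - 1)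
  have hA : 0 ≤ ‖A - 1‖ ^ 2 := by positivity
  nlinarith [mul_le_mul_of_nonneg_left h4 hA]

/-! ### The reduced action on the operator-norm ball around the collapsed vacuum -/

variable {d : ℕ}

/-- `ekCommNormSq` is `frobSq` of the commutator (definitionally). [folklore] -/
theorem ekCommNormSq_eq_frobSq (U : EKConfig d N) (μ ν : Fin d) :
    ekCommNormSq U μ ν = frobSq (ekComm U μ ν) := rfl

/-- **Quartic smallness of the action near the collapsed vacuum, uniformly in `N`**: if
`‖U_μ − 1‖_op ≤ ε` for all `μ` (and `N ≥ 1`), then `S_R[U] ≤ d² ε⁴` — the lattice form of "(14.74)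
has no quadratic term at `P_μ = 0`". [cite: Makeenko2023, §14.5 (14.73)–(14.74) (PDF p. 251)] -/
theorem ekAction_le_of_mem_unitaryOpBall (hN : 0 < N) {ε : ℝ} (U : EKConfig d N)
    (hU : ∀ μ, U μ ∈ unitaryOpBall N ε) : ekAction U ≤ (d : ℝ) ^ 2 * ε ^ 4 := by
  rw [ekAction_eq_sum_ekCommNormSq hN]
  have hN' : (0 : ℝ) < N := by exact_mod_cast hN
  have hterm : ∀ μ ν : Fin d, ekCommNormSq U μ ν / (4 * N) ≤ ε ^ 4 := by
    intro μ ν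
    rw [div_le_iff₀ (by positivity), ekCommNormSq_eq_frobSq]
    have h := frobSq_comm_le (U μ : Matrix (Fin N) (Fin N) ℂ) (U ν : Matrix (Fin N) (Fin N) ℂ)
    have hμ : ‖(U μ : Matrix (Fin N) (Fin N) ℂ) - 1‖ ≤ ε := hU μ
    have hν : ‖(U ν : Matrix (Fin N) (Fin N) ℂ) - 1‖ ≤ ε := hU ν
    have hμ2 : ‖(U μ : Matrix (Fin N) (Fin N) ℂ) - 1‖ ^ 2 ≤ ε ^ 2 :=
      pow_le_pow_left₀ (norm_nonneg _) hμ 2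
    have hν2 : ‖(U ν : Matrix (Fin N) (Fin N) ℂ) - 1‖ ^ 2 ≤ ε ^ 2 :=
      pow_le_pow_left₀ (norm_nonneg _) hν 2
    calc frobSq (ekComm U μ ν)
        = frobSq ((U μ : Matrix (Fin N) (Fin N) ℂ) * (U ν : Matrix (Fin N) (Fin N) ℂ) -
            (U ν : Matrix (Fin N) (Fin N) ℂ) * (U μ : Matrix (Fin N) (Fin N) ℂ)) := rfl
      _ ≤ 4 * N * ‖(U μ : Matrix (Fin N) (Fin N) ℂ) - 1‖ ^ 2 *
            ‖(U ν : Matrix (Fin N) (Fin N) ℂ) - 1‖ ^ 2 := h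
      _ ≤ 4 * N * ε ^ 2 * ε ^ 2 := by gcongr
      _ = ε ^ 4 * (4 * N) := by ring
  calc ∑ μ, ∑ ν, ekCommNormSq U μ ν / (4 * N) ≤ ∑ _μ : Fin d, ∑ _ν : Fin d, ε ^ 4 :=
        Finset.sum_le_sum fun μ _ => Finset.sum_le_sum fun ν _ => hterm μ ν
    _ = (d : ℝ) ^ 2 * ε ^ 4 := by simp; ring

/-! ### The collapsed-vacuum lower bound on `Z_EK` -/

/-- **Discharge of the hypothesis `EKPartitionLowerBound`** (the Laplace exponent `d/4` of the
collapsed vacua), with the explicit constant `C = d log(2π + 1) + d²` and `N₀ = 1`: for all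
`N ≥ 1` and `b ≥ 1`, `Z_N(b) = ∫ ∏ dU_μ e^{−N² b S_R} ≥ exp(−N²((d/4) log b + d log(2π + 1) + d²))`.
Restrict to the box `∏_μ {‖U_μ − 1‖_op ≤ b^{−1/4}}`, where `N² b S_R ≤ d² N²`
(`ekAction_le_of_mem_unitaryOpBall`) and whose measure is `≥ (b^{−1/4}/(2π + 1))^{dN²}`
(`haar_unitaryOpBall_ge`). [cite: Makeenko2023, §14.5 (14.72)–(14.74) (PDF p. 251)] -/
theorem ekPartitionLowerBound_holds (d : ℕ) :
    EKPartitionLowerBound d (d * Real.log (2 * π + 1) + (d : ℝ) ^ 2) := by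
  refine ⟨1, fun N hN b hb => ?_⟩
  have hNpos : 0 < N := hN
  have hb0 : 0 < b := by linarith
  -- the scale ε = b^{-1/4}
  set ε : ℝ := b ^ (-(1 / 4 : ℝ)) with hε
  have hεpos : 0 < ε := Real.rpow_pos_of_pos hb0 _
  have hε1 : ε ≤ 1 := Real.rpow_le_one_of_one_le_of_nonpos hb (by norm_num)
  have hε4 : ε ^ 4 = b⁻¹ := by
    rw [hε, ← Real.rpow_natCast, ← Real.rpow_mul hb0.le]
    norm_num
    exact Real.rpow_neg_one b
  -- the box of near-collapsed configurations
  set Box : Set (EKConfig d N) := Set.pi Set.univ fun _ : Fin d => unitaryOpBall N ε with hBox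
  have hBox_meas : MeasurableSet Box :=
    MeasurableSet.univ_pi fun _ => measurableSet_unitaryOpBall ε
  -- the weight on the box
  have hw : ∀ U ∈ Box, Real.exp (-((d : ℝ) ^ 2 * (N : ℝ) ^ 2)) ≤ ekWeight N b U := by
    intro U hU
    have hU' : ∀ μ, U μ ∈ unitaryOpBall N ε := fun μ => hU μ (Set.mem_univ μ)
    have hS := ekAction_le_of_mem_unitaryOpBall hNpos U hU'
    unfold ekWeight
    rw [Real.exp_le_exp]
    have h1 : b * ekAction U ≤ (d : ℝ) ^ 2 := by
      calc b * ekAction U ≤ b * ((d : ℝ) ^ 2 * ε ^ 4) := by gcongr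
        _ = (d : ℝ) ^ 2 := by rw [hε4]; field_simp
    have h2 : 0 ≤ (N : ℝ) ^ 2 := by positivity
    nlinarith [mul_le_mul_of_nonneg_left h1 h2]
  -- the measure of the box
  have hvol : ENNReal.ofReal (((ε / (2 * π + ε)) ^ (N * N)) ^ d) ≤ ekHaar d N Box := by
    rw [hBox]
    unfold ekHaar
    rw [Measure.pi_pi]
    rw [show (((ε / (2 * π + ε)) ^ (N * N)) ^ d) = ∏ _μ : Fin d, (ε / (2 * π + ε)) ^ (N * N) by
        simp, ENNReal.ofReal_prod_of_nonneg (fun _ _ => by positivity)]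
    exact Finset.prod_le_prod' fun μ _ => haar_unitaryOpBall_ge _ hεpos
  have hBox_fin : ekHaar d N Box ≠ ⊤ := measure_ne_top _ _
  -- the integral over the box
  have hint : Real.exp (-((d : ℝ) ^ 2 * (N : ℝ) ^ 2)) * (ekHaar d N).real Box ≤
      ∫ U, ekWeight N b U ∂ekHaar d N := by
    calc Real.exp (-((d : ℝ) ^ 2 * (N : ℝ) ^ 2)) * (ekHaar d N).real Box
        ≤ ∫ U in Box, ekWeight N b U ∂ekHaar d N :=
          setIntegral_ge_of_const_le_real hBox_meas hBox_fin hw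
            (integrable_ekWeight N b).integrableOn
      _ ≤ ∫ U, ekWeight N b U ∂ekHaar d N :=
          setIntegral_le_integral (integrable_ekWeight N b)
            (Eventually.of_forall fun U => (Real.exp_pos _).le)
  have hreal : ((ε / (2 * π + ε)) ^ (N * N)) ^ d ≤ (ekHaar d N).real Box := by
    rw [measureReal_def, ← ENNReal.ofReal_le_iff_le_toReal hBox_fin]
    exact hvol
  -- compare the target with exp(-d²N²) (ε/(2π+1))^{dN²}
  have hπ : 0 < 2 * π + 1 := by positivity
  have hq : (ε / (2 * π + 1)) ^ (N * N * d) ≤ ((ε / (2 * π + ε)) ^ (N * N)) ^ d := by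
    rw [pow_mul]
    gcongr
  have htarget : Real.exp (-((N : ℝ) ^ 2 * ((d : ℝ) / 4 * Real.log b +
      (d * Real.log (2 * π + 1) + (d : ℝ) ^ 2)))) =
      Real.exp (-((d : ℝ) ^ 2 * (N : ℝ) ^ 2)) * (ε / (2 * π + 1)) ^ (N * N * d) := by
    have hεlog : Real.log ε = -(1 / 4) * Real.log b := by
      rw [hε, Real.log_rpow hb0]
    have hpos : (0 : ℝ) < (ε / (2 * π + 1)) ^ (N * N * d) := by positivity
    rw [← Real.exp_log hpos, ← Real.exp_add, Real.log_pow, Real.log_div hεpos.ne' hπ.ne', hεlog]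
    congr 1
    push_cast
    ring
  rw [htarget]
  calc Real.exp (-((d : ℝ) ^ 2 * (N : ℝ) ^ 2)) * (ε / (2 * π + 1)) ^ (N * N * d)
      ≤ Real.exp (-((d : ℝ) ^ 2 * (N : ℝ) ^ 2)) * (ekHaar d N).real Box := by
        gcongr
        exact hq.trans hreal
    _ ≤ ∫ U, ekWeight N b U ∂ekHaar d N := hint

/-- **The Eguchi–Kawai barrier from the centre-symmetric upper bound alone (proved
implication).** With the collapsed-vacuum lower bound a theorem (`ekPartitionLowerBound_holds`),
`EguchiKawaiBreakdown` follows from the single remaining hypothesis of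
`EguchiKawaiBreakdown_of_bounds`: for every `d ≥ 3`, some `δ > 0`, `e > d/4` and `C` with
`∫_{Sym_δ} ∏ dU_μ e^{−N² b S_R} ≤ exp(−N²(e log b − C))` for all large `N` and all `b ≥ 1`
(`EKSymRegionUpperBound d δ e C` — the quantitative, `N`-uniform form of "for `d ≥ 3` the measure
is singular and the eigenvalues collapse", NOT proved here or in print). [cite: Makeenko2023, §14.3 (PDF p. 246), §14.5 (14.77) (PDF p. 251)] -/
theorem EguchiKawaiBreakdown_of_upperBound
    (h : ∀ d : ℕ, 3 ≤ d → ∃ δ e C : ℝ, 0 < δ ∧ (d : ℝ) / 4 < e ∧ EKSymRegionUpperBound d δ e C) :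
    EguchiKawaiBreakdown := by
  refine EguchiKawaiBreakdown_of_bounds fun d hd => ?_
  obtain ⟨δ, e, C, hδ, he, hUB⟩ := h d hd
  exact ⟨δ, e, _, C, hδ, he, ekPartitionLowerBound_holds d, hUB⟩

/-! ### Sharpness: without centre symmetry the small-ball exponent `d/4` is attained -/

/-- **The unrestricted small-ball probability has exponent at most `d/4`.** For `d, N ≥ 1` and
`t > 0`, with `ε = (t/d²)^{1/4}`,
`Haar^{⊗d} {S_R ≤ t} ≥ (ε/(2π + ε))^{dN²}` (`≈ (c t^{1/4})^{dN²}`): the box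
`∏_μ {‖U_μ − 1‖_op ≤ ε}` lies in `{S_R ≤ d² ε⁴ = t}`. Hence an upper bound
`Haar^{⊗d}(· ∩ {S_R ≤ t}) ≤ e^{CN²} t^{eN²}` with `e > d/4`, as required below of the centre-symmetric
region, is impossible without the restriction to `Sym_δ`. [cite: Makeenko2023, §14.5 (14.72)–(14.74) (PDF p. 251)] -/
theorem ekHaar_action_le_ge (hd : 0 < d) (hN : 0 < N) {t : ℝ} (ht : 0 < t) :
    ENNReal.ofReal ((((t / (d : ℝ) ^ 2) ^ (1 / 4 : ℝ) /
        (2 * π + (t / (d : ℝ) ^ 2) ^ (1 / 4 : ℝ))) ^ (N * N)) ^ d) ≤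
      ekHaar d N {U | ekAction U ≤ t} := by
  have hd' : (0 : ℝ) < d := by exact_mod_cast hd
  set ε : ℝ := (t / (d : ℝ) ^ 2) ^ (1 / 4 : ℝ) with hε
  have hq : 0 < t / (d : ℝ) ^ 2 := by positivity
  have hεpos : 0 < ε := Real.rpow_pos_of_pos hq _
  have hε4 : ε ^ 4 = t / (d : ℝ) ^ 2 := by
    rw [hε, ← Real.rpow_natCast, ← Real.rpow_mul hq.le]
    norm_num
  set Box : Set (EKConfig d N) := Set.pi Set.univ fun _ : Fin d => unitaryOpBall N ε with hBox
  have hsub : Box ⊆ {U | ekAction U ≤ t} := by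
    intro U hU
    have hU' : ∀ μ, U μ ∈ unitaryOpBall N ε := fun μ => hU μ (Set.mem_univ μ)
    have h := ekAction_le_of_mem_unitaryOpBall hN U hU'
    rw [hε4] at h
    show ekAction U ≤ t
    calc ekAction U ≤ (d : ℝ) ^ 2 * (t / (d : ℝ) ^ 2) := h
      _ = t := by field_simp
  refine le_trans ?_ (measure_mono hsub)
  rw [hBox]
  unfold ekHaar
  rw [Measure.pi_pi,
    show (((ε / (2 * π + ε)) ^ (N * N)) ^ d) = ∏ _μ : Fin d, (ε / (2 * π + ε)) ^ (N * N) by simp,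
    ENNReal.ofReal_prod_of_nonneg (fun _ _ => by positivity)]
  exact Finset.prod_le_prod' fun μ _ => haar_unitaryOpBall_ge _ hεpos

/-! ### The residual hypothesis in small-ball form, and the layer-cake reduction -/

/-- **HYPOTHESIS (a property, not an assertion): the `N`-uniform small-ball upper bound for
centre-symmetric almost-commuting unitaries.** `EKSymSmallBallBound d δ e C` says: for all
`N ≥ N₀` and all `t > 0`, the product Haar measure of the `d`-tuples `U ∈ U(N)^d` with all open
lines small, `|(1/N) tr U_μ|² ≤ δ` (`ekSymRegion`), and small reduced action, `S_R[U] ≤ t`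
(equivalently `Σ_{μ,ν} ‖[U_μ,U_ν]‖_F² ≤ 4Nt`), is at most `exp(N²(e log t + C))`. With some
`e > d/4` this is the quantitative content of "for `d ≥ 3` the measure is singular and the
eigenvalues collapse" (the one-loop power count (14.77) predicts
`e = d/4 + (1 − Σ_i f_i²)(d − 2)/4 > d/4` iff `d > 2` around vacua with eigenvalue-cluster
fractions `f_i`, `Σ_i f_i² < 1` being forced by centre symmetry); it is NOT proved here or in
print, and nothing in this file asserts it. For `t ≥ 1` and `C ≥ 0` it is trivially true
(measure `≤ 1`); without `ekSymRegion` it is false for every `e > d/4` (`ekHaar_action_le_ge`).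
[cite: Makeenko2023, §14.5 (14.77) (PDF p. 251)] [cite: BhanotHellerNeuberger1982] -/
def EKSymSmallBallBound (d : ℕ) (δ e C : ℝ) : Prop :=
  ∃ N₀ : ℕ, ∀ N : ℕ, N₀ ≤ N → ∀ t : ℝ, 0 < t →
    ekHaar d N (ekSymRegion d N δ ∩ {U | ekAction U ≤ t}) ≤
      ENNReal.ofReal (Real.exp ((N : ℝ) ^ 2 * (e * Real.log t + C)))

/-- `∫₀¹ t^{−1/2} dt = 2` as a Lebesgue integral over `(0, 1]`. [folklore] -/
theorem lintegral_rpow_neg_half_Ioc :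
    ∫⁻ t in Ioc (0 : ℝ) 1, ENNReal.ofReal (t ^ (-(1 / 2 : ℝ))) = ENNReal.ofReal 2 := by
  have hr : (-1 : ℝ) < -(1 / 2 : ℝ) := by norm_num
  have hfi : IntegrableOn (fun t : ℝ => t ^ (-(1 / 2 : ℝ))) (Ioc 0 1) volume :=
    (intervalIntegral.intervalIntegrable_rpow' hr (a := 0) (b := 1)).1
  have hnn : 0 ≤ᵐ[volume.restrict (Ioc (0 : ℝ) 1)] fun t : ℝ => t ^ (-(1 / 2 : ℝ)) := by
    filter_upwards [ae_restrict_mem measurableSet_Ioc] with t ht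
    exact Real.rpow_nonneg ht.1.le _
  rw [← ofReal_integral_eq_lintegral_ofReal hfi hnn, ← intervalIntegral.integral_of_le zero_le_one,
    integral_rpow (Or.inl hr)]
  congr 1
  norm_num

/-- The elementary inequality behind the Laplace bound: for `e, b, L > 0`,
`e log L ≤ e (log(2e) − 1 − log b) + bL/2` — i.e. `log y ≤ y − 1` at `y = bL/(2e)`; equivalently
`L^{e} e^{−bL/2} ≤ (2e/(𝐞b))^{e}`. [folklore] -/
theorem e_mul_log_le {e b L : ℝ} (he : 0 < e) (hb : 0 < b) (hL : 0 < L) :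
    e * Real.log L ≤ e * (Real.log (2 * e) - 1 - Real.log b) + b * L / 2 := by
  have hy : 0 < b * L / (2 * e) := by positivity
  have h := Real.log_le_sub_one_of_pos hy
  rw [Real.log_div (by positivity) (by positivity), Real.log_mul hb.ne' hL.ne',
    Real.log_mul two_ne_zero he.ne'] at h
  have h2e : Real.log (2 * e) = Real.log 2 + Real.log e := Real.log_mul two_ne_zero he.ne'
  rw [h2e]
  have : e * (Real.log b + Real.log L - (Real.log 2 + Real.log e)) ≤ e * (b * L / (2 * e) - 1) :=
    mul_le_mul_of_nonneg_left h he.le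
  have hsimp : e * (b * L / (2 * e) - 1) = b * L / 2 - e := by field_simp
  rw [hsimp] at this
  nlinarith

/-- **Layer-cake (Laplace) reduction: the small-ball bound implies the centre-symmetric upper
bound `EKSymRegionUpperBound`** with the same exponent `e` and the constant
`C' = C + e log(2e) − e + log 2` (for `N ≥ max N₀ 1`, `b ≥ 1`):
`∫_{Sym_δ} e^{−N² b S_R} = ∫₀¹ Haar(Sym_δ ∩ {S_R < −log s/(N²b)}) ds ≤ ∫₀¹ e^{N²(C + e log(2e) − e − e log b)} s^{−1/2} ds`.
[folklore] -/
theorem ekSymRegionUpperBound_of_smallBall {δ e C : ℝ} (he : 0 < e)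
    (h : EKSymSmallBallBound d δ e C) :
    EKSymRegionUpperBound d δ e (C + e * Real.log (2 * e) - e + Real.log 2) := by
  obtain ⟨N₀, hN₀⟩ := h
  refine ⟨max N₀ 1, fun N hN b hb => ?_⟩
  have hNN₀ : N₀ ≤ N := le_trans (le_max_left _ _) hN
  have hN1 : 1 ≤ N := le_trans (le_max_right _ _) hN
  have hNr : (1 : ℝ) ≤ N := by exact_mod_cast hN1
  have hb0 : 0 < b := by linarith
  have hN2b : 0 < (N : ℝ) ^ 2 * b := by positivity
  set μ := ekHaar d N with hμ
  set A := ekSymRegion d N δ with hA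
  set g : EKConfig d N → ℝ := fun U => ekWeight N b U with hg
  set K : ℝ := (N : ℝ) ^ 2 * (C + e * Real.log (2 * e) - e - e * Real.log b) with hK
  set M : ℝ := Real.exp K with hM
  have hMpos : 0 < M := Real.exp_pos _
  -- the set integral as a lower Lebesgue integral
  have hg_nn : 0 ≤ᵐ[μ.restrict A] g := Eventually.of_forall fun U => (Real.exp_pos _).le
  have hg_cont : Continuous g := continuous_ekWeight N b
  have h1 : ∫ U in A, g U ∂μ = (∫⁻ U in A, ENNReal.ofReal (g U) ∂μ).toReal :=
    integral_eq_lintegral_of_nonneg_ae hg_nn hg_cont.aestronglyMeasurable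
  -- layer cake
  have h2 : ∫⁻ U in A, ENNReal.ofReal (g U) ∂μ = ∫⁻ t in Ioi 0, (μ.restrict A) {U | t < g U} :=
    lintegral_eq_lintegral_meas_lt _ hg_nn hg_cont.aemeasurable
  -- pointwise bound on the level-set measures
  set F : ℝ → ℝ≥0∞ := fun t => ENNReal.ofReal (M * t ^ (-(1 / 2 : ℝ))) with hF
  have h3 : ∀ t ∈ Ioi (0 : ℝ), (μ.restrict A) {U | t < g U} ≤ (Ioc (0 : ℝ) 1).indicator F t := by
    intro t ht
    have ht0 : 0 < t := ht
    have hmeas : MeasurableSet {U : EKConfig d N | t < g U} :=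
      (isOpen_lt continuous_const hg_cont).measurableSet
    rw [Measure.restrict_apply hmeas]
    by_cases ht1 : t < 1
    · -- 0 < t < 1: {t < g} ⊆ {S_R ≤ L}, L = -log t/(N² b) > 0
      rw [indicator_of_mem (show t ∈ Ioc (0 : ℝ) 1 from ⟨ht0, ht1.le⟩)]
      set L : ℝ := -Real.log t / ((N : ℝ) ^ 2 * b) with hL
      have hlogt : Real.log t < 0 := Real.log_neg ht0 ht1
      have hLpos : 0 < L := div_pos (by linarith) hN2b
      have hlogt' : Real.log t = -((N : ℝ) ^ 2 * b * L) := by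
        rw [hL]; field_simp
      have hsub : {U : EKConfig d N | t < g U} ∩ A ⊆ A ∩ {U | ekAction U ≤ L} := by
        rintro U ⟨hU, hUA⟩
        refine ⟨hUA, ?_⟩
        show ekAction U ≤ L
        have hU' : t < Real.exp (-((N : ℝ) ^ 2 * b) * ekAction U) := hU
        rw [← Real.exp_log ht0, Real.exp_lt_exp, hlogt'] at hU'
        by_contra hcon
        push Not at hcon
        nlinarith
      calc μ ({U : EKConfig d N | t < g U} ∩ A) ≤ μ (A ∩ {U | ekAction U ≤ L}) := measure_mono hsub
        _ ≤ ENNReal.ofReal (Real.exp ((N : ℝ) ^ 2 * (e * Real.log L + C))) := hN₀ N hNN₀ L hLpos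
        _ ≤ F t := by
          rw [hF]
          apply ENNReal.ofReal_le_ofReal
          rw [hM, Real.rpow_def_of_pos ht0, ← Real.exp_add, Real.exp_le_exp, hK, hlogt']
          have hkey := e_mul_log_le he hb0 hLpos
          have hN2 : (0 : ℝ) ≤ (N : ℝ) ^ 2 := by positivity
          have := mul_le_mul_of_nonneg_left hkey hN2
          nlinarith
    · -- t ≥ 1: the level set is empty (the weight is ≤ 1)
      have hempty : {U : EKConfig d N | t < g U} = ∅ := by
        apply Set.eq_empty_of_forall_notMem
        intro U hU
        have hU' : t < Real.exp (-((N : ℝ) ^ 2 * b) * ekAction U) := hU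
        have hle : Real.exp (-((N : ℝ) ^ 2 * b) * ekAction U) ≤ 1 := by
          rw [Real.exp_le_one_iff]
          have := ekAction_nonneg U
          nlinarith
        push Not at ht1
        linarith
      rw [hempty, Set.empty_inter, measure_empty]
      exact bot_le
  -- integrate the bound: ∫₀¹ M t^{-1/2} dt = 2M
  have h4 : ∫⁻ t in Ioi 0, (μ.restrict A) {U | t < g U} ≤
      ∫⁻ t in Ioi (0 : ℝ), (Ioc (0 : ℝ) 1).indicator F t :=
    setLIntegral_mono' measurableSet_Ioi h3
  have h5 : ∫⁻ t in Ioi (0 : ℝ), (Ioc (0 : ℝ) 1).indicator F t =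
      ENNReal.ofReal M * ENNReal.ofReal 2 := by
    rw [lintegral_indicator measurableSet_Ioc, Measure.restrict_restrict measurableSet_Ioc,
      Set.inter_eq_left.2 Set.Ioc_subset_Ioi_self]
    have hFeq : ∀ t : ℝ, t ∈ Ioc (0 : ℝ) 1 →
        F t = ENNReal.ofReal M * ENNReal.ofReal (t ^ (-(1 / 2 : ℝ))) := by
      intro t _
      simp only [hF]
      rw [ENNReal.ofReal_mul hMpos.le]
    rw [setLIntegral_congr_fun measurableSet_Ioc hFeq, lintegral_const_mul' _ _ ENNReal.ofReal_ne_top,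
      lintegral_rpow_neg_half_Ioc]
  have h6 : ∫ U in A, g U ∂μ ≤ 2 * M := by
    rw [h1]
    refine ENNReal.toReal_le_of_le_ofReal (by positivity) ?_
    rw [h2]
    refine h4.trans ?_
    rw [h5, ← ENNReal.ofReal_mul hMpos.le, mul_comm]
  -- 2M ≤ exp(-N²(e log b - C'))
  calc ∫ U in A, g U ∂μ ≤ 2 * M := h6
    _ ≤ Real.exp (-((N : ℝ) ^ 2 *
          (e * Real.log b - (C + e * Real.log (2 * e) - e + Real.log 2)))) := by
      rw [hM, hK]
      have h2le : (2 : ℝ) ≤ Real.exp ((N : ℝ) ^ 2 * Real.log 2) := by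
        have : Real.log 2 ≤ (N : ℝ) ^ 2 * Real.log 2 := by
          have hl : 0 < Real.log 2 := Real.log_pos one_lt_two
          have hN2 : (1 : ℝ) ≤ (N : ℝ) ^ 2 := one_le_pow₀ hNr
          have := mul_le_mul_of_nonneg_right hN2 hl.le
          linarith
        calc (2 : ℝ) = Real.exp (Real.log 2) := (Real.exp_log two_pos).symm
          _ ≤ _ := Real.exp_le_exp.2 this
      calc 2 * Real.exp ((N : ℝ) ^ 2 * (C + e * Real.log (2 * e) - e - e * Real.log b))
          ≤ Real.exp ((N : ℝ) ^ 2 * Real.log 2) *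
              Real.exp ((N : ℝ) ^ 2 * (C + e * Real.log (2 * e) - e - e * Real.log b)) := by
            gcongr
        _ = _ := by rw [← Real.exp_add]; congr 1; ring

/-- **The Eguchi–Kawai barrier from ONE `N`-uniform small-ball estimate (proved implication).**
`EguchiKawaiBreakdown` — for every `d ≥ 3`, failure of `⟨|(1/N) tr U_μ|²⟩_EK → 0` at all
sufficiently weak couplings — follows from: for every `d ≥ 3` some `δ > 0`, `e > d/4`, `C` with
`Haar^{⊗d}(Sym_δ ∩ {S_R ≤ t}) ≤ exp(N²(e log t + C))` for all large `N` and all `t > 0`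
(`EKSymSmallBallBound`). Everything else — the exact symmetry, the collapsed-vacuum lower bound
with exponent `d/4`, the free-energy comparison and the order-parameter inequality — is proved
in this unit. [cite: Makeenko2023, §14.3 (PDF p. 246), §14.5 (14.77) (PDF p. 251)] [cite: BhanotHellerNeuberger1982] -/
theorem EguchiKawaiBreakdown_of_smallBall
    (h : ∀ d : ℕ, 3 ≤ d → ∃ δ e C : ℝ, 0 < δ ∧ (d : ℝ) / 4 < e ∧ EKSymSmallBallBound d δ e C) :
    EguchiKawaiBreakdown := by
  refine EguchiKawaiBreakdown_of_upperBound fun d hd => ?_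
  obtain ⟨δ, e, C, hδ, he, hSB⟩ := h d hd
  have he0 : 0 < e := lt_of_le_of_lt (by positivity) he
  exact ⟨δ, e, _, hδ, he, ekSymRegionUpperBound_of_smallBall he0 hSB⟩

/-! ### The other bracket: the symmetric small-ball exponent is at most `d/2` -/

/-- `frobSq` of a unitary matrix is `N` (its columns are unit vectors). [folklore] -/
theorem frobSq_unitary (W : UN N) : frobSq (W : Matrix (Fin N) (Fin N) ℂ) = N := by
  rw [frobSq, Finset.sum_comm]
  simp [sum_norm_sq_col W]

/-- `frobSq (A + B) ≤ 2 frobSq A + 2 frobSq B`. [folklore] -/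
theorem frobSq_add_le (A B : Matrix (Fin N) (Fin N) ℂ) :
    frobSq (A + B) ≤ 2 * frobSq A + 2 * frobSq B := by
  have h := frobSq_sub_le A (-B)
  rw [sub_neg_eq_add] at h
  have hneg : frobSq (-B) = frobSq B := by simp [frobSq]
  rwa [hneg] at h

/-- **Quadratic smallness of the action near ANY commuting unitary `D` put on all links**: if
`‖U_μ − D‖_op ≤ ε ≤ 1` for all `μ` (`N ≥ 1`), then `S_R[U] ≤ 4 d² ε²`
(`[U_μ,U_ν] = [U_μ − D, U_ν] + [D, U_ν − D]`). [folklore] -/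
theorem ekAction_le_of_near_const (hN : 0 < N) (D : UN N) {ε : ℝ} (U : EKConfig d N)
    (hU : ∀ μ, ‖(U μ : Matrix (Fin N) (Fin N) ℂ) - (D : Matrix (Fin N) (Fin N) ℂ)‖ ≤ ε) :
    ekAction U ≤ 4 * (d : ℝ) ^ 2 * ε ^ 2 := by
  haveI : Nonempty (Fin N) := ⟨⟨0, hN⟩⟩
  rw [ekAction_eq_sum_ekCommNormSq hN]
  have hN' : (0 : ℝ) < N := by exact_mod_cast hN
  have hDn : ‖(D : Matrix (Fin N) (Fin N) ℂ)‖ = 1 := CStarRing.norm_coe_unitary D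
  have hterm : ∀ μ ν : Fin d, ekCommNormSq U μ ν / (4 * N) ≤ 4 * ε ^ 2 := by
    intro μ ν
    rw [div_le_iff₀ (by positivity), ekCommNormSq_eq_frobSq]
    set A : Matrix (Fin N) (Fin N) ℂ := (U μ : Matrix (Fin N) (Fin N) ℂ) with hA
    set B : Matrix (Fin N) (Fin N) ℂ := (U ν : Matrix (Fin N) (Fin N) ℂ) with hB
    set Dm : Matrix (Fin N) (Fin N) ℂ := (D : Matrix (Fin N) (Fin N) ℂ) with hDm
    have hBn : ‖B‖ = 1 := CStarRing.norm_coe_unitary (U ν)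
    have hsplit : ekComm U μ ν = ((A - Dm) * B - B * (A - Dm)) + (Dm * (B - Dm) - (B - Dm) * Dm) := by
      show A * B - B * A = _
      noncomm_ring
    have hεA : ‖A - Dm‖ ≤ ε := hU μ
    have hεB : ‖B - Dm‖ ≤ ε := hU ν
    have hε0 : 0 ≤ ε := (norm_nonneg _).trans hεA
    have hfB : frobSq B = N := frobSq_unitary (U ν)
    have hfBD : frobSq (B - Dm) ≤ N * ‖B - Dm‖ ^ 2 := frobSq_le_card_mul _
    -- the four products
    have h1 : frobSq ((A - Dm) * B) ≤ ‖A - Dm‖ ^ 2 * N := by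
      have := frobSq_mul_le (A - Dm) B; rwa [hfB] at this
    have h2 : frobSq (B * (A - Dm)) ≤ ‖A - Dm‖ ^ 2 * N := by
      have := frobSq_mul_le' (A - Dm) B; rwa [hfB] at this
    have h3 : frobSq (Dm * (B - Dm)) ≤ N * ‖B - Dm‖ ^ 2 := by
      have := frobSq_mul_le Dm (B - Dm); rw [hDn, one_pow, one_mul] at this; exact this.trans hfBD
    have h4 : frobSq ((B - Dm) * Dm) ≤ N * ‖B - Dm‖ ^ 2 := by
      have := frobSq_mul_le' Dm (B - Dm); rw [hDn, one_pow, one_mul] at this; exact this.trans hfBD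
    have hA2 : ‖A - Dm‖ ^ 2 ≤ ε ^ 2 := pow_le_pow_left₀ (norm_nonneg _) hεA 2
    have hB2 : ‖B - Dm‖ ^ 2 ≤ ε ^ 2 := pow_le_pow_left₀ (norm_nonneg _) hεB 2
    rw [hsplit]
    calc frobSq (((A - Dm) * B - B * (A - Dm)) + (Dm * (B - Dm) - (B - Dm) * Dm))
        ≤ 2 * frobSq ((A - Dm) * B - B * (A - Dm)) + 2 * frobSq (Dm * (B - Dm) - (B - Dm) * Dm) :=
          frobSq_add_le _ _
      _ ≤ 2 * (2 * frobSq ((A - Dm) * B) + 2 * frobSq (B * (A - Dm))) +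
          2 * (2 * frobSq (Dm * (B - Dm)) + 2 * frobSq ((B - Dm) * Dm)) := by
          gcongr <;> exact frobSq_sub_le _ _
      _ ≤ 2 * (2 * (ε ^ 2 * N) + 2 * (ε ^ 2 * N)) + 2 * (2 * (N * ε ^ 2) + 2 * (N * ε ^ 2)) := by
          gcongr
          · exact h1.trans (by nlinarith)
          · exact h2.trans (by nlinarith)
          · exact h3.trans (by nlinarith)
          · exact h4.trans (by nlinarith)
      _ = 4 * ε ^ 2 * (4 * N) := by ring
  calc ∑ μ, ∑ ν, ekCommNormSq U μ ν / (4 * N) ≤ ∑ _μ : Fin d, ∑ _ν : Fin d, 4 * ε ^ 2 :=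
        Finset.sum_le_sum fun μ _ => Finset.sum_le_sum fun ν _ => hterm μ ν
    _ = 4 * (d : ℝ) ^ 2 * ε ^ 2 := by simp; ring

/-- Open lines near `D`: `|(1/N) tr U_μ| ≤ |(1/N) tr D| + ‖U_μ − D‖_op` (entries are bounded by
the operator norm). [folklore] -/
theorem norm_openLine_le_of_near (hN : 0 < N) (D : UN N) (U : EKConfig d N) (μ : Fin d) :
    ‖openLine μ U‖ ≤ ‖Matrix.trace (D : Matrix (Fin N) (Fin N) ℂ) / N‖ +
      ‖(U μ : Matrix (Fin N) (Fin N) ℂ) - (D : Matrix (Fin N) (Fin N) ℂ)‖ := by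
  have hN' : (0 : ℝ) < N := by exact_mod_cast hN
  set E : Matrix (Fin N) (Fin N) ℂ := (U μ : Matrix (Fin N) (Fin N) ℂ) - (D : Matrix (Fin N) (Fin N) ℂ)
    with hE
  have hsplit : openLine μ U = Matrix.trace (D : Matrix (Fin N) (Fin N) ℂ) / N + Matrix.trace E / N := by
    rw [openLine, hE, Matrix.trace_sub]; ring
  rw [hsplit]
  refine (norm_add_le _ _).trans (add_le_add le_rfl ?_)
  rw [norm_div, Complex.norm_natCast, div_le_iff₀ hN']
  calc ‖Matrix.trace E‖ = ‖∑ i, E i i‖ := rfl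
    _ ≤ ∑ i, ‖E i i‖ := norm_sum_le _ _
    _ ≤ ∑ _i : Fin N, ‖E‖ := Finset.sum_le_sum fun i _ => norm_entry_le_l2_opNorm E i i
    _ = ‖E‖ * N := by simp [mul_comm]

/-- A traceless diagonal unitary of even size: `diag(1,…,1,−1,…,−1)` realised as
`diag((−1)^{i})`, i.e. alternating signs. [folklore] -/
def signDiag (N : ℕ) : UN N :=
  ⟨Matrix.diagonal fun i : Fin N => ((-1 : ℂ) ^ (i : ℕ)), by
    rw [Matrix.mem_unitaryGroup_iff, Matrix.star_eq_conjTranspose, Matrix.diagonal_conjTranspose,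
      Matrix.diagonal_mul_diagonal, ← Matrix.diagonal_one]
    congr 1
    funext i
    have : star ((-1 : ℂ) ^ (i : ℕ)) = (-1 : ℂ) ^ (i : ℕ) := by simp
    rw [Pi.star_apply, this, ← pow_add, ← two_mul, pow_mul]
    norm_num⟩

/-- For even `N` the alternating sign matrix is traceless. [folklore] -/
theorem trace_signDiag_of_even {N : ℕ} (hN : Even N) :
    Matrix.trace ((signDiag N : UN N) : Matrix (Fin N) (Fin N) ℂ) = 0 := by
  obtain ⟨m, rfl⟩ := hN
  show Matrix.trace (Matrix.diagonal fun i : Fin (m + m) => ((-1 : ℂ) ^ (i : ℕ))) = 0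
  rw [Matrix.trace_diagonal]
  induction m with
  | zero => simp
  | succ k ih =>
    rw [show k + 1 + (k + 1) = (k + k) + 2 by ring, Fin.sum_univ_castSucc, Fin.sum_univ_castSucc]
    simp only [Fin.val_castSucc, Fin.val_last]
    rw [ih]
    ring

/-- **The centre-symmetric small-ball exponent is at most `d/2`** (the other bracket of the
open estimate): for `d ≥ 1`, `δ > 0` and ANY `e > d/2`, `C`, the bound `EKSymSmallBallBound d δ e C`
FAILS. Around the centre-symmetric commuting tuple `U_μ = D` (all `μ`), `D = diag(±1)` traceless
(`N` even), the action is only QUADRATICALLY small (`S_R ≤ 4d²ε²` on `∏_μ {‖U_μ − D‖_op ≤ ε}`,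
`ekAction_le_of_near_const`), the box is centre-symmetric for `ε² ≤ δ`, and its measure is
`≥ (ε/(2π + 1))^{dN²}` (left translate of `haar_unitaryOpBall_ge`): so
`Haar^{⊗d}(Sym_δ ∩ {S_R ≤ t}) ≥ (c √t)^{dN²}`. Together with `EguchiKawaiBreakdown_of_smallBall`
(which needs `e > d/4`) this locates the missing estimate in the window `d/4 < e ≤ d/2` (the
one-loop prediction being `(3d − 2)/8` as `δ → 0`). [folklore] -/
theorem not_ekSymSmallBallBound_of_half_lt (hd : 0 < d) {δ e C : ℝ} (hδ : 0 < δ)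
    (he : (d : ℝ) / 2 < e) : ¬ EKSymSmallBallBound d δ e C := by
  rintro ⟨N₀, h⟩
  -- an even N ≥ N₀, N ≥ 2
  set N : ℕ := 2 * (N₀ + 1) with hNdef
  have hN₀N : N₀ ≤ N := by rw [hNdef]; omega
  have hNpos : 0 < N := by rw [hNdef]; omega
  have hNeven : Even N := ⟨N₀ + 1, by rw [hNdef]; ring⟩
  have hNr : (0 : ℝ) < N := by exact_mod_cast hNpos
  have hd' : (0 : ℝ) < d := by exact_mod_cast hd
  have h2ed : 0 < 2 * e - d := by linarith
  -- the scale ε = exp(-T)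
  set R : ℝ := (e * Real.log (4 * (d : ℝ) ^ 2) + C + d * Real.log (2 * π + 1)) / (2 * e - d) with hR
  set T : ℝ := |R| + 1 + |Real.log δ| / 2 with hT
  have hT0 : 0 < T := by rw [hT]; positivity
  have hTR : R < T := by rw [hT]; have := le_abs_self R; have := abs_nonneg (Real.log δ); linarith
  set ε : ℝ := Real.exp (-T) with hε
  have hεpos : 0 < ε := Real.exp_pos _
  have hε1 : ε ≤ 1 := by rw [hε, Real.exp_le_one_iff]; linarith
  have hlogε : Real.log ε = -T := by rw [hε, Real.log_exp]
  have hε2δ : ε ^ 2 ≤ δ := by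
    have h1 : ε ^ 2 = Real.exp (-(2 * T)) := by
      rw [hε, ← Real.exp_nat_mul]; congr 1; push_cast; ring
    have h2 : Real.exp (-(2 * T)) ≤ Real.exp (-|Real.log δ|) := by
      rw [Real.exp_le_exp, hT]; have := abs_nonneg R; linarith
    have h3 : Real.exp (-|Real.log δ|) ≤ δ := by
      rcases le_or_gt (Real.log δ) 0 with hl | hl
      · rw [abs_of_nonpos hl, neg_neg, Real.exp_log hδ]
      · rw [abs_of_pos hl]
        have : Real.exp (-Real.log δ) ≤ Real.exp (Real.log δ) := Real.exp_le_exp.2 (by linarith)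
        rwa [Real.exp_log hδ] at this
    rw [h1]; exact h2.trans h3
  set t : ℝ := 4 * (d : ℝ) ^ 2 * ε ^ 2 with ht
  have htpos : 0 < t := by positivity
  -- the box around D
  set D : UN N := signDiag N with hD
  have htrD : Matrix.trace (D : Matrix (Fin N) (Fin N) ℂ) = 0 := trace_signDiag_of_even hNeven
  set ballD : Set (UN N) := (fun V => D⁻¹ * V) ⁻¹' unitaryOpBall N ε with hballD
  have hballD_meas : MeasurableSet ballD :=
    (measurableSet_unitaryOpBall ε).preimage (measurable_const_mul _)
  haveI : Nonempty (Fin N) := ⟨⟨0, hNpos⟩⟩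
  have hDn : ‖(D : Matrix (Fin N) (Fin N) ℂ)‖ = 1 := CStarRing.norm_coe_unitary D
  have hnear : ∀ V ∈ ballD, ‖(V : Matrix (Fin N) (Fin N) ℂ) - (D : Matrix (Fin N) (Fin N) ℂ)‖ ≤ ε := by
    intro V hV
    have hV' : ‖((D⁻¹ * V : UN N) : Matrix (Fin N) (Fin N) ℂ) - 1‖ ≤ ε := hV
    have hDD : (D : Matrix (Fin N) (Fin N) ℂ) * star (D : Matrix (Fin N) (Fin N) ℂ) = 1 :=
      Unitary.coe_mul_star_self D
    have hfac : (V : Matrix (Fin N) (Fin N) ℂ) - (D : Matrix (Fin N) (Fin N) ℂ) =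
        (D : Matrix (Fin N) (Fin N) ℂ) * (((D⁻¹ * V : UN N) : Matrix (Fin N) (Fin N) ℂ) - 1) := by
      show _ = (D : Matrix (Fin N) (Fin N) ℂ) * (star (D : Matrix (Fin N) (Fin N) ℂ) * (V : Matrix (Fin N) (Fin N) ℂ) - 1)
      rw [mul_sub, ← mul_assoc, hDD, one_mul, mul_one]
    rw [hfac]
    calc _ ≤ ‖(D : Matrix (Fin N) (Fin N) ℂ)‖ * ‖((D⁻¹ * V : UN N) : Matrix (Fin N) (Fin N) ℂ) - 1‖ :=
          norm_mul_le _ _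
      _ ≤ 1 * ε := by rw [hDn]; gcongr
      _ = ε := one_mul ε
  set BoxD : Set (EKConfig d N) := Set.pi Set.univ fun _ : Fin d => ballD with hBoxD
  -- the box is centre symmetric with small action
  have hsub : BoxD ⊆ ekSymRegion d N δ ∩ {U | ekAction U ≤ t} := by
    intro U hU
    have hU' : ∀ μ, ‖(U μ : Matrix (Fin N) (Fin N) ℂ) - (D : Matrix (Fin N) (Fin N) ℂ)‖ ≤ ε :=
      fun μ => hnear _ (hU μ (Set.mem_univ μ))
    refine ⟨?_, ?_⟩
    · intro μ
      have h1 := norm_openLine_le_of_near hNpos D U μ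
      rw [htrD, zero_div, norm_zero, zero_add] at h1
      have h2 : ‖openLine μ U‖ ≤ ε := h1.trans (hU' μ)
      calc ‖openLine μ U‖ ^ 2 ≤ ε ^ 2 := pow_le_pow_left₀ (norm_nonneg _) h2 2
        _ ≤ δ := hε2δ
    · show ekAction U ≤ t
      rw [ht]
      exact ekAction_le_of_near_const hNpos D U hU'
  -- its measure
  have hvol : ENNReal.ofReal (((ε / (2 * π + 1)) ^ (N * N)) ^ d) ≤ ekHaar d N BoxD := by
    rw [hBoxD]
    unfold ekHaar
    rw [Measure.pi_pi,
      show (((ε / (2 * π + 1)) ^ (N * N)) ^ d) = ∏ _μ : Fin d, (ε / (2 * π + 1)) ^ (N * N) by simp,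
      ENNReal.ofReal_prod_of_nonneg (fun _ _ => by positivity)]
    refine Finset.prod_le_prod' fun μ _ => ?_
    rw [hballD, measure_preimage_mul]
    refine le_trans (ENNReal.ofReal_le_ofReal ?_) (haar_unitaryOpBall_ge _ hεpos)
    gcongr
  -- the contradiction
  have hchain := (hvol.trans (measure_mono hsub)).trans (h N hN₀N t htpos)
  rw [ENNReal.ofReal_le_ofReal_iff (Real.exp_pos _).le] at hchain
  have hpos : (0 : ℝ) < ((ε / (2 * π + 1)) ^ (N * N)) ^ d := by positivity
  have hlog := Real.log_le_log hpos hchain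
  rw [Real.log_exp, Real.log_pow, Real.log_pow, Real.log_div hεpos.ne' (by positivity), hlogε,
    ht] at hlog
  have hlogt : Real.log (4 * (d : ℝ) ^ 2 * ε ^ 2) = Real.log (4 * (d : ℝ) ^ 2) - 2 * T := by
    rw [Real.log_mul (by positivity) (by positivity), Real.log_pow, hlogε]; ring
  rw [hlogt] at hlog
  -- hlog : d * (N*N * (-T - log(2π+1))) ≤ N² (e (log(4d²) - 2T) + C)
  have hN2 : (0 : ℝ) < (N : ℝ) ^ 2 := by positivity
  have key : (2 * e - d) * T ≤ e * Real.log (4 * (d : ℝ) ^ 2) + C + d * Real.log (2 * π + 1) := by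
    have h' : (N : ℝ) ^ 2 * ((2 * e - d) * T) ≤
        (N : ℝ) ^ 2 * (e * Real.log (4 * (d : ℝ) ^ 2) + C + d * Real.log (2 * π + 1)) := by
      push_cast at hlog
      nlinarith [hlog]
    exact le_of_mul_le_mul_left h' hN2
  have key2 : T ≤ R := by
    rw [hR, le_div_iff₀ h2ed]; linarith
  linarith

/-! ### The two forms of the residual hypothesis are equivalent; the exponent window of `EKSymRegionUpperBound` -/

/-- The sub-level sets of the reduced action are closed. [folklore] -/
theorem isClosed_ekAction_le (t : ℝ) : IsClosed {U : EKConfig d N | ekAction U ≤ t} :=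
  isClosed_le continuous_ekAction continuous_const

/-- **Chebyshev step.** For `b ≥ 0`:
`Haar^{⊗d}(Sym_δ ∩ {S_R ≤ t}) · e^{−N² b t} ≤ ∫_{Sym_δ} e^{−N² b S_R}` (on the sub-level set the
Boltzmann weight is at least `e^{−N² b t}`). [folklore] -/
theorem measureReal_symRegion_inter_mul_exp_le (N : ℕ) {b : ℝ} (hb : 0 ≤ b) (δ t : ℝ) :
    (ekHaar d N).real (ekSymRegion d N δ ∩ {U | ekAction U ≤ t}) * Real.exp (-((N : ℝ) ^ 2 * b * t)) ≤
      ∫ U in ekSymRegion d N δ, ekWeight N b U ∂ekHaar d N := by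
  set A : Set (EKConfig d N) := ekSymRegion d N δ ∩ {U | ekAction U ≤ t} with hA
  have hAm : MeasurableSet A :=
    (measurableSet_ekSymRegion δ).inter (isClosed_ekAction_le t).measurableSet
  have hw : Integrable (ekWeight N b) (ekHaar d N) := integrable_ekWeight N b
  -- on `A` the weight is at least the constant
  have hconst : ∀ U ∈ A, Real.exp (-((N : ℝ) ^ 2 * b * t)) ≤ ekWeight N b U := by
    intro U hU
    unfold ekWeight
    rw [Real.exp_le_exp]
    have hS : ekAction U ≤ t := hU.2
    have hN2 : (0 : ℝ) ≤ (N : ℝ) ^ 2 * b := by positivity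
    nlinarith [mul_le_mul_of_nonneg_left hS hN2]
  calc (ekHaar d N).real A * Real.exp (-((N : ℝ) ^ 2 * b * t))
      = ∫ _U in A, Real.exp (-((N : ℝ) ^ 2 * b * t)) ∂ekHaar d N := by
        rw [setIntegral_const, smul_eq_mul]
    _ ≤ ∫ U in A, ekWeight N b U ∂ekHaar d N := by
        refine setIntegral_mono_on (integrable_const _).integrableOn hw.integrableOn hAm hconst
    _ ≤ ∫ U in ekSymRegion d N δ, ekWeight N b U ∂ekHaar d N :=
        setIntegral_mono_set hw.integrableOn (Eventually.of_forall fun U => (Real.exp_pos _).le)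
          (Eventually.of_forall (Set.inter_subset_left : A ⊆ ekSymRegion d N δ))

/-- **Upper bound ⇒ small-ball bound.** The free-energy form `EKSymRegionUpperBound d δ e C` of the
residual hypothesis (`EguchiKawaiBreakdownProofs.lean`) implies its small-ball form with constant
`max C 0 + 1` (take `b = 1/t` in the Chebyshev step for `t < 1`; `t ≥ 1` is trivial), for `e ≥ 0`.
With `ekSymRegionUpperBound_of_smallBall` the two forms are therefore EQUIVALENT up to the
constants. [folklore] -/
theorem ekSymSmallBallBound_of_upperBound {δ e C : ℝ} (he : 0 ≤ e)
    (h : EKSymRegionUpperBound d δ e C) : EKSymSmallBallBound d δ e (max C 0 + 1) := by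
  obtain ⟨N₀, hUB⟩ := h
  refine ⟨N₀, fun N hN t ht => ?_⟩
  set A : Set (EKConfig d N) := ekSymRegion d N δ ∩ {U | ekAction U ≤ t} with hA
  have hfin : ekHaar d N A ≠ ∞ := measure_ne_top _ _
  rw [← ENNReal.ofReal_toReal hfin]
  refine ENNReal.ofReal_le_ofReal ?_
  change (ekHaar d N).real A ≤ _
  have hreal_le_one : (ekHaar d N).real A ≤ 1 := by
    calc (ekHaar d N).real A ≤ (ekHaar d N).real Set.univ := measureReal_mono (Set.subset_univ _)
      _ = 1 := probReal_univ
  have hN2 : (0 : ℝ) ≤ (N : ℝ) ^ 2 := by positivity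
  rcases le_or_gt 1 t with ht1 | ht1
  · -- t ≥ 1: the bound is at least 1
    refine hreal_le_one.trans ?_
    rw [Real.one_le_exp_iff]
    refine mul_nonneg hN2 ?_
    have : 0 ≤ Real.log t := Real.log_nonneg ht1
    have : 0 ≤ max C 0 := le_max_right _ _
    nlinarith
  · -- t < 1: Chebyshev at b = 1/t ≥ 1
    set b : ℝ := 1 / t with hb
    have hbpos : 0 < b := by rw [hb]; positivity
    have hb1 : 1 ≤ b := by rw [hb, le_div_iff₀ ht]; linarith
    have hcheb := measureReal_symRegion_inter_mul_exp_le (d := d) N hbpos.le δ t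
    have hU := hUB N hN b hb1
    have hbt : (N : ℝ) ^ 2 * b * t = (N : ℝ) ^ 2 := by
      rw [hb]; field_simp
    rw [hbt] at hcheb
    have hlogb : Real.log b = -Real.log t := by
      rw [hb, one_div, Real.log_inv]
    rw [hlogb] at hU
    -- μ(A) ≤ e^{N²} · exp(−N²(−e log t − C)) = exp(N²(e log t + C + 1))
    have h1 : (ekHaar d N).real A ≤
        Real.exp ((N : ℝ) ^ 2) * Real.exp (-((N : ℝ) ^ 2 * (e * -Real.log t - C))) := by
      have hexp : 0 < Real.exp (-((N : ℝ) ^ 2)) := Real.exp_pos _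
      have := hcheb.trans hU
      calc (ekHaar d N).real A
          = (ekHaar d N).real A * Real.exp (-((N : ℝ) ^ 2)) * Real.exp ((N : ℝ) ^ 2) := by
            rw [mul_assoc, ← Real.exp_add, neg_add_cancel, Real.exp_zero, mul_one]
        _ ≤ Real.exp (-((N : ℝ) ^ 2 * (e * -Real.log t - C))) * Real.exp ((N : ℝ) ^ 2) :=
            mul_le_mul_of_nonneg_right this (Real.exp_pos _).le
        _ = _ := mul_comm _ _
    refine h1.trans ?_
    rw [← Real.exp_add, Real.exp_le_exp]
    have : C ≤ max C 0 := le_max_left _ _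
    nlinarith

/-- **The exponent window of the residual hypothesis (audit 2026-08-16).** For `d ≥ 1`, `δ > 0`
and ANY `e > d/2`, `C`, the free-energy hypothesis `EKSymRegionUpperBound d δ e C` of
`EguchiKawaiBreakdownProofs.lean` is FALSE (transfer of `not_ekSymSmallBallBound_of_half_lt`
through `ekSymSmallBallBound_of_upperBound`: around the centre-symmetric commuting tuple
`U_μ = diag(±1)` the action is only quadratically small). Since `EguchiKawaiBreakdown_of_bounds` /
`EguchiKawaiBreakdown_of_upperBound` need it with `e > d/4`, the hypothesis is useful and possibly
true only in the window `d/4 < e ≤ d/2` (one-loop prediction: true for `e < (3d − 2)/8 − O(√δ)`,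
false above, by the antipodal two-cluster vacuum; neither proved). In particular the interface of
the reduction theorems is NOT vacuous by excess (`e ≤ d/4` useless) nor trivially inhabited
(`e > d/2` refuted): what remains is a genuine `N`-uniform estimate. [folklore] -/
theorem not_ekSymRegionUpperBound_of_half_lt (hd : 0 < d) {δ e C : ℝ} (hδ : 0 < δ)
    (he : (d : ℝ) / 2 < e) : ¬ EKSymRegionUpperBound d δ e C := fun h =>
  not_ekSymSmallBallBound_of_half_lt hd hδ he
    (ekSymSmallBallBound_of_upperBound (le_of_lt (lt_of_le_of_lt (by positivity) he)) h)

/-- Hence the hypothesis of `EguchiKawaiBreakdown_of_bounds` can only be met with exponents in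
`(d/4, d/2]`: any admissible `e` there satisfies `e ≤ d/2`. [folklore] -/
theorem exponent_le_half_of_ekSymRegionUpperBound (hd : 0 < d) {δ e C : ℝ} (hδ : 0 < δ)
    (h : EKSymRegionUpperBound d δ e C) : e ≤ (d : ℝ) / 2 := by
  by_contra hlt
  exact not_ekSymRegionUpperBound_of_half_lt hd hδ (lt_of_not_ge hlt) h

end Literature.Barriers.QuantumFields

end
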